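import Mathlib.Algebra.Order.ToIntervalMod
import Literature.Analysis.FluidPDE.PeriodicBoundedMildTorus
import Literature.Analysis.FunctionSpaces.TorusClassicalNSRestart
import Literature.Analysis.FunctionSpaces.TorusClassicalNSUniqueness
import HarnessLib

/-!
# Classical Navier–Stokes solutions on the flat torus: time translation, concatenation of local
# solutions along a schedule of restart times, and periodic extension

Function-space support file (all results proved; no definitions, no named facts) for the accepted
notion `Torus.IsClassicalNSSolutionOn S ν f u p` of `TorusFluidGlue`, continuing
`TorusClassicalNSGluing` / `TorusClassicalNSRestart` (locality in time, pressure normalisation,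
gluing two solutions) and `TorusClassicalNSUniqueness` (identification on the overlap): the
bookkeeping of the "restart and continue" construction with COUNTABLY MANY pieces, and the closing up
of a solution that repeats itself.

* `Torus.IsClassicalNSSolutionOn.comp_sub_const` — time translation, subtractive form of the accepted
  `Torus.IsClassicalNSSolutionOn.comp_add_const` (`PeriodicBoundedMildTorus`);
* `exists_mem_Ioc_of_strictMono_of_tendsto`, `eq_of_mem_Ioc_of_strictMono` — the slots `(Tₙ, Tₙ₊₁]`
  of a schedule `T₀ < T₁ < ⋯ → ∞` partition `(T₀, ∞)`;
* `Torus.tendsto_integral_norm_sub_sq_of_tendsto` — the `L²` seam hypothesis of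
  `velocity_unique_Ioc_of_tendsto` from `L²`-convergence to the anchor's initial value;
* `Torus.IsClassicalNSSolutionOn.concat_schedule` — **concatenation along a schedule** (steady
  force): local classical solutions `wₙ` on `(0, ρₙ + rₙ]`, each issued in `L²` from the value of the
  previous one at its transit time, placed at `Tₙ₊₁ = Tₙ + ρₙ → ∞`, concatenate to a classical
  solution on `(T₀, ∞)` reading `wₙ(· − Tₙ)` on the slot `(Tₙ, Tₙ₊₁]` (pressures normalised at a base
  point; consecutive pieces agree on the overlaps by uniqueness, so `of_local` applies —
  Robinson–Rodrigo–Sadowski 2016, §8.1: restart, identify on the overlap, iterate);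
* `Torus.IsClassicalNSSolutionOn.concat_schedule_periodic` — repeating data (`T_{n+M} = Tₙ + P`,
  `w_{n+M} = wₙ`) give a concatenation that is `P`-periodic on `(T₀, ∞)`;
* `Torus.IsClassicalNSSolutionOn.periodic_extension` — a classical solution on `(a, ∞)` which is
  `P`-periodic there extends to a `P`-periodic classical solution on `ℝ` (reduce the time modulo `P`
  into `(a, a + P]`, Mathlib `toIocMod`; locally a time translate of the given solution).

Tree search (`lean search 'Torus.IsClassicalNSSolutionOn\\.(translate|periodic|concat)'`): only the
time translation `….comp_add_const` (reused). Mathlib: `toIocMod_mem_Ioc`, `toIocMod_add_right`,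
`Nat.find`, `Int.eq_nat_or_neg`.

## References

* J. C. Robinson, J. L. Rodrigo, W. Sadowski, *The Three-Dimensional Navier–Stokes Equations.
  Classical Theory*, CUP 2016, §6.3 (Lemma 6.11) and §8.1. [RobinsonRodrigoSadowskiCUP2016]
* A. J. Majda, A. L. Bertozzi, *Vorticity and Incompressible Flow*, CUP 2002, §3.1.1, Cor. 3.1.
-/

open MeasureTheory Set Filter
open _root_.Topology
open scoped InnerProductSpace ContDiff

noncomputable section

namespace Literature.Analysis.FunctionSpaces

/-! ## Locating a time in a strictly increasing schedule -/

section Locate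

/-- In a strictly increasing schedule `T₀ < T₁ < ⋯ → ∞` every time `t > T₀` lies in some slot
`(Tₙ, Tₙ₊₁]`. [folklore] -/
theorem exists_mem_Ioc_of_strictMono_of_tendsto {T : ℕ → ℝ} (hT : StrictMono T)
    (htop : Tendsto T atTop atTop) {t : ℝ} (ht : T 0 < t) : ∃ n, t ∈ Ioc (T n) (T (n + 1)) := by
  classical
  have hex : ∃ n, t ≤ T (n + 1) := by
    obtain ⟨n, hn⟩ := (htop.eventually (eventually_ge_atTop t)).exists
    exact ⟨n, hn.trans (hT.monotone (Nat.le_succ n))⟩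
  refine ⟨Nat.find hex, ?_, Nat.find_spec hex⟩
  rcases h : Nat.find hex with _ | n
  · exact ht
  · have hmin := Nat.find_min hex (m := n) (by omega)
    exact lt_of_not_ge hmin

/-- The slots `(Tₙ, Tₙ₊₁]` of a strictly increasing schedule are pairwise disjoint. [folklore] -/
theorem eq_of_mem_Ioc_of_strictMono {T : ℕ → ℝ} (hT : StrictMono T) {t : ℝ} {n m : ℕ}
    (hn : t ∈ Ioc (T n) (T (n + 1))) (hm : t ∈ Ioc (T m) (T (m + 1))) : n = m := by
  by_contra hne
  rcases lt_or_gt_of_ne hne with h | h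
  · exact absurd (hn.2.trans (hT.monotone (Nat.succ_le_of_lt h))) (not_le.2 hm.1)
  · exact absurd (hm.2.trans (hT.monotone (Nat.succ_le_of_lt h))) (not_le.2 hn.1)

end Locate

namespace Torus

variable {d : Type*} [Fintype d] [DecidableEq d]

/-! ## Time translation (subtractive form) -/

section Translate

variable {S : Set ℝ} {ν : ℝ} {f u : ℝ → UnitAddTorus d → EuclideanSpace ℝ d}
  {p : ℝ → UnitAddTorus d → ℝ}

/-- Time translation of classical solutions on the torus, subtractive form: `(u(· − c), p(· − c))`
solves with force `f(· − c)` on `(· − c)⁻¹' S` (from the accepted additive form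
`Torus.IsClassicalNSSolutionOn.comp_add_const` of `PeriodicBoundedMildTorus` at `−c`). [folklore] -/
theorem IsClassicalNSSolutionOn.comp_sub_const (h : IsClassicalNSSolutionOn S ν f u p) (c : ℝ) :
    IsClassicalNSSolutionOn ((· - c) ⁻¹' S) ν (fun t => f (t - c)) (fun t => u (t - c))
      (fun t => p (t - c)) := by
  have h' := h.comp_add_const (-c); simp only [← sub_eq_add_neg] at h'; exact h'

end Translate

/-! ## The `L²` seam hypothesis from convergence to the anchor's initial value -/

section Seam

omit [DecidableEq d] in
/-- If `∫ ‖u₁(t) − u₂(a)‖² → 0` as `t → a⁺`, `u₁(t)` is smooth for `t` slightly above `a`, and `u₂`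
is jointly smooth on `[a, b] × T^d` (`a < b`), then `∫ ‖u₁(t) − u₂(t)‖² → 0` as `t → a⁺`
(parallelogram bound through `u₂(a)` and uniform continuity of `u₂` in time on the compact torus,
`vol(T^d) = 1`). The `L²` form of `Torus.tendsto_integral_norm_sub_sq_of_uniform`. [folklore] -/
theorem tendsto_integral_norm_sub_sq_of_tendsto {a b : ℝ}
    {u₁ u₂ : ℝ → UnitAddTorus d → EuclideanSpace ℝ d} (hu₂ : IsSmoothSpaceTimeOn (Icc a b) u₂)
    (hab : a < b) (hu₁ : ∀ᶠ t in 𝓝[>] a, IsSmooth (u₁ t))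
    (h : Tendsto (fun t => ∫ x, ‖u₁ t x - u₂ a x‖ ^ 2) (𝓝[>] a) (𝓝 0)) :
    Tendsto (fun t => ∫ x, ‖u₁ t x - u₂ t x‖ ^ 2) (𝓝[>] a) (𝓝 0) := by
  rw [Metric.tendsto_nhds]
  intro ε hε
  obtain ⟨η, hη, hηε⟩ : ∃ η : ℝ, 0 < η ∧ 2 * η + 2 * η ^ 2 < ε := by
    refine ⟨min 1 (ε / 8), by positivity, ?_⟩
    have h0 : 0 < min 1 (ε / 8) := by positivity
    nlinarith [min_le_left 1 (ε / 8), min_le_right 1 (ε / 8)]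
  have hle : 𝓝[>] a ≤ 𝓝[Icc a b] a := nhdsWithin_le_iff.2 (Icc_mem_nhdsGT hab)
  have hcont : ∀ᶠ t in 𝓝[>] a, ∀ x, ‖u₂ t x - u₂ a x‖ < η :=
    (hu₂.eventually_norm_sub_lt ⟨le_rfl, hab.le⟩ hη).filter_mono hle
  have hsmall : ∀ᶠ t in 𝓝[>] a, ∫ x, ‖u₁ t x - u₂ a x‖ ^ 2 < η := by
    have := (Metric.tendsto_nhds.1 h) η hη
    filter_upwards [this] with t ht
    rwa [Real.dist_eq, sub_zero, abs_of_nonneg (integral_nonneg fun x => sq_nonneg _)] at ht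
  have hmem : ∀ᶠ t in 𝓝[>] a, t ∈ Icc a b :=
    mem_of_superset (Ioo_mem_nhdsGT hab) fun t ht => ⟨ht.1.le, ht.2.le⟩
  have hu₂a : IsSmooth (u₂ a) := hu₂.isSmooth_slice ⟨le_rfl, hab.le⟩
  filter_upwards [hu₁, hcont, hsmall, hmem] with t h1 h2 h3 h4
  have hu₂t : IsSmooth (u₂ t) := hu₂.isSmooth_slice h4
  have hiA : Integrable (fun x => ‖u₁ t x - u₂ a x‖ ^ 2) := (h1.sub hu₂a).norm_sq.integrable
  have hiB : Integrable (fun x => ‖u₂ a x - u₂ t x‖ ^ 2) := (hu₂a.sub hu₂t).norm_sq.integrable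
  have hiC : Integrable (fun x => ‖u₁ t x - u₂ t x‖ ^ 2) := (h1.sub hu₂t).norm_sq.integrable
  have hpt : ∀ x, ‖u₁ t x - u₂ t x‖ ^ 2 ≤ 2 * ‖u₁ t x - u₂ a x‖ ^ 2 + 2 * η ^ 2 := fun x => by
    have hx : ‖u₁ t x - u₂ t x‖ ≤ ‖u₁ t x - u₂ a x‖ + ‖u₂ a x - u₂ t x‖ :=
      norm_sub_le_norm_sub_add_norm_sub _ _ _
    have hb : ‖u₂ a x - u₂ t x‖ ≤ η := by rw [norm_sub_rev]; exact (h2 x).le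
    have hA : ‖u₁ t x - u₂ t x‖ ≤ ‖u₁ t x - u₂ a x‖ + η := hx.trans (by linarith)
    have hA2 : ‖u₁ t x - u₂ t x‖ ^ 2 ≤ (‖u₁ t x - u₂ a x‖ + η) ^ 2 :=
      pow_le_pow_left₀ (norm_nonneg _) hA 2
    nlinarith [sq_nonneg (‖u₁ t x - u₂ a x‖ - η)]
  have hint : ∫ x, ‖u₁ t x - u₂ t x‖ ^ 2 ≤ 2 * (∫ x, ‖u₁ t x - u₂ a x‖ ^ 2) + 2 * η ^ 2 :=
    calc ∫ x, ‖u₁ t x - u₂ t x‖ ^ 2 ≤ ∫ x, (2 * ‖u₁ t x - u₂ a x‖ ^ 2 + 2 * η ^ 2) :=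
          integral_mono hiC ((hiA.const_mul 2).add (integrable_const _)) hpt
      _ = 2 * (∫ x, ‖u₁ t x - u₂ a x‖ ^ 2) + 2 * η ^ 2 := by
          rw [integral_add (hiA.const_mul 2) (integrable_const _), integral_const_mul]
          simp
  rw [Real.dist_eq, sub_zero, abs_of_nonneg (integral_nonneg fun x => sq_nonneg _)]
  nlinarith

end Seam

/-! ## Concatenation of local solutions along a schedule -/

section Concat

variable {ν : ℝ} {F : UnitAddTorus d → EuclideanSpace ℝ d}

/-- **Concatenation of local classical solutions along a schedule (autonomous force).** Let
`T₀ < T₁ < ⋯`, `Tₙ₊₁ = Tₙ + ρₙ`, `Tₙ → ∞`, and for every `n` let `(wₙ, πₙ)` be a classical solution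
of NS_ν with the steady force `F` on the local time window `(0, ρₙ + rₙ]`, `rₙ > 0`, such that the
next piece is issued from the value of the current one at its transit time:
`∫ ‖wₙ₊₁(s) − wₙ(ρₙ)‖² → 0` as `s → 0⁺`. Then there is a classical solution `(u, p)` on `(T₀, ∞)`
with `u = wₙ(· − Tₙ)` and `p = πₙ(· − Tₙ) − πₙ(· − Tₙ, x₀)` on every slot `(Tₙ, Tₙ₊₁]`. (On the
overlap `(Tₙ₊₁, Tₙ₊₁ + min rₙ ρₙ₊₁]` the pieces `n` and `n + 1` agree by
`velocity_unique_Ioc_of_tendsto`, so near every time the concatenation is a time translate of a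
single piece and `of_local` applies.) This is the iterated restart-and-identify construction
(Robinson–Rodrigo–Sadowski 2016, §8.1). [folklore] -/
theorem IsClassicalNSSolutionOn.concat_schedule (hν : 0 ≤ ν) {T ρ r : ℕ → ℝ}
    (hρ : ∀ n, 0 < ρ n) (hr : ∀ n, 0 < r n) (hT : ∀ n, T (n + 1) = T n + ρ n)
    (htop : Tendsto T atTop atTop)
    {w : ℕ → ℝ → UnitAddTorus d → EuclideanSpace ℝ d} {π : ℕ → ℝ → UnitAddTorus d → ℝ}
    (hw : ∀ n, IsClassicalNSSolutionOn (Ioc 0 (ρ n + r n)) ν (fun _ => F) (w n) (π n))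
    (hseam : ∀ n, Tendsto (fun s => ∫ x, ‖w (n + 1) s x - w n (ρ n) x‖ ^ 2) (𝓝[>] 0) (𝓝 0))
    (x₀ : UnitAddTorus d) :
    ∃ (u : ℝ → UnitAddTorus d → EuclideanSpace ℝ d) (p : ℝ → UnitAddTorus d → ℝ),
      IsClassicalNSSolutionOn (Ioi (T 0)) ν (fun _ => F) u p ∧
      (∀ n, ∀ t ∈ Ioc (T n) (T (n + 1)), u t = w n (t - T n)) ∧
      (∀ n, ∀ t ∈ Ioc (T n) (T (n + 1)), p t = fun x => π n (t - T n) x - π n (t - T n) x₀) := by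
  classical
  have hmono : StrictMono T := strictMono_nat_of_lt_succ fun n => by rw [hT]; linarith [hρ n]
  -- the slot index of a time
  have hex : ∀ t : ℝ, ∃ n : ℕ, t ≤ T (n + 1) := fun t => by
    obtain ⟨n, hn⟩ := (htop.eventually (eventually_ge_atTop t)).exists
    exact ⟨n, hn.trans (hmono.monotone (Nat.le_succ n))⟩
  set κ : ℝ → ℕ := fun t => Nat.find (hex t) with hκ_def
  have hκ : ∀ {n : ℕ} {t : ℝ}, t ∈ Ioc (T n) (T (n + 1)) → κ t = n := by
    intro n t ht
    have h1 : κ t ≤ n := Nat.find_min' (hex t) ht.2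
    rcases h1.lt_or_eq with hlt | heq
    · exfalso
      have h2 : t ≤ T (κ t + 1) := Nat.find_spec (hex t)
      exact absurd ((h2.trans (hmono.monotone (Nat.succ_le_of_lt hlt))).trans_lt ht.1) (lt_irrefl _)
    · exact heq
  -- overlap widths and the seams
  set b : ℕ → ℝ := fun n => min (r n) (ρ (n + 1)) with hb_def
  have hb : ∀ n, 0 < b n := fun n => lt_min (hr n) (hρ (n + 1))
  have hshift : ∀ n, IsClassicalNSSolutionOn (Icc 0 (b n)) ν (fun _ => F)
      (fun s => w n (s + ρ n)) (fun s => π n (s + ρ n)) := fun n =>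
    ((hw n).comp_add_const (ρ n)).mono
      (fun s hs => ⟨by simpa using add_pos_of_nonneg_of_pos hs.1 (hρ n),
        by have := min_le_left (r n) (ρ (n + 1)); simp only; linarith [hs.2]⟩)
      (uniqueDiffOn_Icc (hb n))
  have hseam' : ∀ n, ∀ s ∈ Ioc 0 (b n), w (n + 1) s = w n (s + ρ n) := by
    intro n s hs
    have h₁ : IsClassicalNSSolutionOn (Ioc 0 (b n)) ν (fun _ => F) (w (n + 1)) (π (n + 1)) :=
      (hw (n + 1)).mono (fun s hs => ⟨hs.1, hs.2.trans ((min_le_right _ _).trans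
        (by linarith [hr (n + 1)]))⟩) (uniqueDiffOn_Ioc 0 (b n))
    refine h₁.velocity_unique_Ioc_of_tendsto hν (hshift n) ?_ hs
    refine tendsto_integral_norm_sub_sq_of_tendsto (hshift n).smooth_velocity (hb n) ?_ ?_
    · filter_upwards [Ioc_mem_nhdsGT (hb n)] with t ht using h₁.smooth_velocity.isSmooth_slice ht
    · simpa using hseam n
  -- the concatenated fields
  refine ⟨fun t => w (κ t) (t - T (κ t)),
    fun t x => π (κ t) (t - T (κ t)) x - π (κ t) (t - T (κ t)) x₀, ?_,
    fun n t ht => by simp only [hκ ht], fun n t ht => by simp only [hκ ht]⟩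
  refine IsClassicalNSSolutionOn.of_local isOpen_Ioi fun t ht => ?_
  obtain ⟨n, hn⟩ := exists_mem_Ioc_of_strictMono_of_tendsto hmono htop ht
  -- near `t ∈ (Tₙ, Tₙ₊₁]` the concatenation is the translate of piece `n`
  have hpiece : IsClassicalNSSolutionOn (Ioo (T n) (T (n + 1) + b n)) ν (fun _ => F)
      (fun s => w n (s - T n)) (fun s x => π n (s - T n) x - π n (s - T n) x₀) :=
    (((hw n).comp_sub_const (T n)).mono (fun s hs => ⟨by simpa using hs.1, by
        have := min_le_left (r n) (ρ (n + 1)); simp only; linarith [hs.2, hT n]⟩)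
      isOpen_Ioo.uniqueDiffOn).sub_pressure_apply x₀
  have hnext : IsClassicalNSSolutionOn (Ioc (T (n + 1)) (T (n + 1) + (ρ (n + 1) + r (n + 1)))) ν
      (fun _ => F) (fun s => w (n + 1) (s - T (n + 1))) (fun s => π (n + 1) (s - T (n + 1))) :=
    ((hw (n + 1)).comp_sub_const (T (n + 1))).mono
      (fun s hs => ⟨by simpa using hs.1, by simp only; linarith [hs.2]⟩) (uniqueDiffOn_Ioc _ _)
  -- values of the concatenation on the overlap slot
  have hov : ∀ s ∈ Ioo (T (n + 1)) (T (n + 1) + b n), w (n + 1) (s - T (n + 1)) = w n (s - T n) :=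
    fun s hs => by
    rw [hseam' n (s - T (n + 1)) ⟨by linarith [hs.1], by linarith [hs.2]⟩, hT n]
    ring_nf
  refine ⟨Ioo (T n) (T (n + 1) + b n), isOpen_Ioo, ⟨hn.1, hn.2.trans_lt (by linarith [hb n])⟩,
    fun s hs => (hmono.monotone (Nat.zero_le n)).trans_lt hs.1, _, _, hpiece, fun s hs => ?_,
    fun s hs => ?_⟩
  · by_cases hsT : s ≤ T (n + 1)
    · simp only [hκ ⟨hs.1, hsT⟩]
    · have hs' : s ∈ Ioc (T (n + 1)) (T (n + 1 + 1)) :=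
        ⟨not_le.1 hsT, by rw [hT (n + 1)]; linarith [hs.2, min_le_right (r n) (ρ (n + 1))]⟩
      simp only [hκ hs']
      exact (hov s ⟨not_le.1 hsT, hs.2⟩).symm
  · by_cases hsT : s ≤ T (n + 1)
    · simp only [hκ ⟨hs.1, hsT⟩]
    · have hTs : T (n + 1) < s := not_le.1 hsT
      have hs' : s ∈ Ioc (T (n + 1)) (T (n + 1 + 1)) :=
        ⟨hTs, by rw [hT (n + 1)]; linarith [hs.2, min_le_right (r n) (ρ (n + 1))]⟩
      simp only [hκ hs']
      funext x
      -- the normalised pressures of pieces `n` and `n + 1` agree on the open overlap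
      have heq : ∀ᶠ τ in 𝓝 s, (fun τ => w (n + 1) (τ - T (n + 1))) τ = (fun τ => w n (τ - T n)) τ := by
        filter_upwards [Ioo_mem_nhds hTs hs.2] with τ hτ using hov τ hτ
      have h := hnext.pressure_sub_eq_of_eventuallyEq hpiece
        (Ioc_mem_nhds hTs (by linarith [hs.2, min_le_right (r n) (ρ (n + 1)), hr (n + 1)]))
        (Ioo_mem_nhds hs.1 hs.2) heq x x₀
      linarith

omit [Fintype d] [DecidableEq d] in
/-- **The concatenation of repeating data is periodic.** If the schedule and the pieces repeat after
`M` slots — `T_{n+M} = Tₙ + P`, `w_{n+M} = wₙ`, `π_{n+M} = πₙ` — then every pair `(u, p)` reading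
`wₙ(· − Tₙ)`, `πₙ(· − Tₙ) − πₙ(· − Tₙ, x₀)` on the slots `(Tₙ, Tₙ₊₁]` (as produced by
`concat_schedule`) satisfies `u(t + P) = u(t)`, `p(t + P) = p(t)` for `t > T₀`. [folklore] -/
theorem IsClassicalNSSolutionOn.concat_schedule_periodic {T : ℕ → ℝ} (hmono : StrictMono T)
    (htop : Tendsto T atTop atTop) {M : ℕ} {P : ℝ} (hTM : ∀ n, T (n + M) = T n + P)
    {w : ℕ → ℝ → UnitAddTorus d → EuclideanSpace ℝ d} {π : ℕ → ℝ → UnitAddTorus d → ℝ}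
    (hwM : ∀ n, w (n + M) = w n) (hπM : ∀ n, π (n + M) = π n) (x₀ : UnitAddTorus d)
    {u : ℝ → UnitAddTorus d → EuclideanSpace ℝ d} {p : ℝ → UnitAddTorus d → ℝ}
    (hu : ∀ n, ∀ t ∈ Ioc (T n) (T (n + 1)), u t = w n (t - T n))
    (hp : ∀ n, ∀ t ∈ Ioc (T n) (T (n + 1)), p t = fun x => π n (t - T n) x - π n (t - T n) x₀) :
    (∀ t ∈ Ioi (T 0), u (t + P) = u t) ∧ (∀ t ∈ Ioi (T 0), p (t + P) = p t) := by
  have key : ∀ t ∈ Ioi (T 0), ∃ n, t ∈ Ioc (T n) (T (n + 1)) ∧ t + P ∈ Ioc (T (n + M)) (T (n + M + 1)) := by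
    intro t ht
    obtain ⟨n, hn⟩ := exists_mem_Ioc_of_strictMono_of_tendsto hmono htop ht
    refine ⟨n, hn, ?_, ?_⟩
    · rw [hTM]; linarith [hn.1]
    · rw [Nat.add_right_comm, hTM]; linarith [hn.2]
  constructor
  · intro t ht
    obtain ⟨n, hn, hnP⟩ := key t ht
    rw [hu n t hn, hu (n + M) (t + P) hnP, hwM, hTM, show t + P - (T n + P) = t - T n by ring]
  · intro t ht
    obtain ⟨n, hn, hnP⟩ := key t ht
    rw [hp n t hn, hp (n + M) (t + P) hnP, hπM, hTM, show t + P - (T n + P) = t - T n by ring]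

end Concat

/-! ## Periodic extension of a solution that repeats itself -/

section Periodic

variable {ν : ℝ} {f : ℝ → UnitAddTorus d → EuclideanSpace ℝ d}

/-- **Periodic extension.** Let `(u, p)` be a classical solution on `(a, ∞)` with a `P`-periodic
force, `P > 0`, such that `u(t + P) = u(t)` and `p(t + P) = p(t)` for all `t > a`. Then there is a
`P`-periodic classical solution `(U, Q)` on all of `ℝ` (same force) with `U = u`, `Q = p` on
`(a, ∞)`: put `U(t) = u(t mod P ∈ (a, a + P])` (Mathlib `toIocMod`); near every time `U` is a
translate `u(· − kP)` of the given solution, so `of_local` applies. [folklore] -/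
theorem IsClassicalNSSolutionOn.periodic_extension {a P : ℝ} (hP : 0 < P)
    {u : ℝ → UnitAddTorus d → EuclideanSpace ℝ d} {p : ℝ → UnitAddTorus d → ℝ}
    (h : IsClassicalNSSolutionOn (Ioi a) ν f u p) (hf : Function.Periodic f P)
    (hu : ∀ t ∈ Ioi a, u (t + P) = u t) (hp : ∀ t ∈ Ioi a, p (t + P) = p t) :
    ∃ (U : ℝ → UnitAddTorus d → EuclideanSpace ℝ d) (Q : ℝ → UnitAddTorus d → ℝ),
      IsClassicalNSSolutionOn univ ν f U Q ∧ Function.Periodic U P ∧ Function.Periodic Q P ∧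
      (∀ t ∈ Ioi a, U t = u t) ∧ (∀ t ∈ Ioi a, Q t = p t) := by
  -- values at times differing by a multiple of the period agree
  have hnat : ∀ t ∈ Ioi a, ∀ n : ℕ, u (t + n • P) = u t ∧ p (t + n • P) = p t := by
    intro t ht n
    induction n with
    | zero => simp
    | succ n ih =>
      have htn : t + n • P ∈ Ioi a := by
        have : (0 : ℝ) ≤ n • P := by positivity
        exact lt_of_lt_of_le ht (le_add_of_nonneg_right this)
      rw [succ_nsmul, ← add_assoc, hu _ htn, hp _ htn]
      exact ih
  have hint : ∀ t₁ ∈ Ioi a, ∀ t₂ ∈ Ioi a, ∀ j : ℤ, t₁ = t₂ + j • P → u t₁ = u t₂ ∧ p t₁ = p t₂ := by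
    intro t₁ ht₁ t₂ ht₂ j hj
    obtain ⟨n, rfl | rfl⟩ := j.eq_nat_or_neg
    · rw [hj, natCast_zsmul]; exact hnat t₂ ht₂ n
    · rw [show t₂ = t₁ + n • P by rw [hj, neg_zsmul, natCast_zsmul]; ring]
      exact ⟨(hnat t₁ ht₁ n).1.symm, (hnat t₁ ht₁ n).2.symm⟩
  have hmem : ∀ t, toIocMod hP a t ∈ Ioi a := fun t => (toIocMod_mem_Ioc hP a t).1
  have hf' : ∀ (k : ℤ) (t : ℝ), f (t - k • P) = f t := fun k t => by
    have h := hf.zsmul (-k) t; rwa [neg_zsmul, ← sub_eq_add_neg] at h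
  refine ⟨fun t => u (toIocMod hP a t), fun t => p (toIocMod hP a t), ?_,
    fun t => by simp only [toIocMod_add_right], fun t => by simp only [toIocMod_add_right],
    fun t ht => (hint _ (hmem t) t ht (-toIocDiv hP a t) (by rw [toIocMod, neg_zsmul]; ring)).1,
    fun t ht => (hint _ (hmem t) t ht (-toIocDiv hP a t) (by rw [toIocMod, neg_zsmul]; ring)).2⟩
  refine IsClassicalNSSolutionOn.of_local isOpen_univ fun t _ => ?_
  set k : ℤ := toIocDiv hP a t with hk
  have htk : a < t - k • P := hmem t
  have hsol : IsClassicalNSSolutionOn (Ioi (a + k • P)) ν f (fun s => u (s - k • P))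
      (fun s => p (s - k • P)) := by
    have h1 := (h.comp_sub_const (k • P)).mono (S' := Ioi (a + k • P))
      (fun s hs => by simp only [mem_preimage, mem_Ioi] at hs ⊢; linarith) isOpen_Ioi.uniqueDiffOn
    simp only [hf'] at h1
    exact h1
  refine ⟨Ioi (a + k • P), isOpen_Ioi, by simp only [mem_Ioi]; linarith, subset_univ _, _, _, hsol,
    fun s hs => ?_, fun s hs => ?_⟩
  · exact (hint _ (by simp only [mem_Ioi] at hs ⊢; linarith) _ (hmem s) (toIocDiv hP a s - k)
      (by rw [toIocMod, sub_zsmul]; ring)).1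
  · exact (hint _ (by simp only [mem_Ioi] at hs ⊢; linarith) _ (hmem s) (toIocDiv hP a s - k)
      (by rw [toIocMod, sub_zsmul]; ring)).2

end Periodic

end Torus

end Literature.Analysis.FunctionSpaces
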